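import Literature.MathematicalPhysics.QuantumFieldTheory.Balaban1983to89.B4TorusRegionOp
import Literature.MathematicalPhysics.QuantumFieldTheory.Balaban1983to89.B4CubeOpReindex

/-!
# `Balaban1983to89.B4TorusRegionLift` — [Balaban1983RegularityDecay] p. 572 «a torus T_η which we identify with a
# rectangular parallelepiped in ηZ^d with periodic conditions»: THE PERIODIC LIFT OF A TORUS REGION TO THE LATTICE
# `ηℤ^{d+1}` — the `(2R+1)^{d+1}` translated copies `Ω̃_R` of the period box, the projection `π` (reduction of
# representatives), the pull-back `u ∘ π` of fields, and the INTERTWINING IDENTITIES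
# `(H^{ℤ}_{Ω̃_R}(A^per)(u∘π))(x̃) = (H^{T}_{Ω}(A)u)(πx̃)`, `(D^{ℤ}_μ(u∘π))(x̃) = (D^{T}_μ u)(πx̃)` off the outermost copies,
# with the sup-norm size of `H^{ℤ}` (the defect on the outermost copies is `O(n²)·‖u‖_∞`)

statement-level skeleton of published theorems with citation tags; proofs where landed; nothing here is a claim about the Yang–Mills mass gap

CITATION HEADER.  T. Bałaban, *Regularity and decay of lattice Green's functions*, Commun. Math. Phys. **89** (1983)
571–597, doi:10.1007/bf01214744 [Balaban1983RegularityDecay] (cell paper B4; held text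
`paper:balaban1983-cmp89-regularity-decay`, journal page = PDF page + 570; p. 572 [PDF 2]).  Unit `lit-balaban-r01` gen 9
(B4 fold owner; HOME `run/shared/lean/pub/lit-balaban/`), SKELETON rows **B4.Thm@573** / **B4.Eq1.8** (torus qualifier),
file 2 of the r01 g9 programme «the Theorem on torus region pairs by periodic lifting».  Imports r01 g9 `B4TorusRegionOp`
(torus operator/derivative, `twrap`, `perField`), p17 `B4CubeOpReindex` (`covOp_eq_blockOp'`/`covKer`: the block kernel
of (1.6)).

WHAT IS PRINTED (p. 572 [PDF 2], verbatim).  «Another common case is to consider operators on subsets of a torus T_η which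
we identify with a rectangular parallelepiped in ηZ^d with periodic conditions.»  (1.3)–(1.6) as transcribed in
`B4GaugeCovariance`.  The periodic lift is OUR device (not in the print) for transferring the Theorem p. 573, proved in
the tree on finite unions of big blocks of `ηℤ^{d+1}` (`B4ThmRegionPairEta`), to the torus regions the print also covers:
a function on a torus region, composed with the reduction of representatives, is a function on the lifted lattice region
on which the lattice operator (1.6) at the periodic field acts as the torus operator does — except on the outermost
copies, where lattice Neumann conditions cut the bonds that wrap around.

WHAT THIS MODULE PROVES (all in full; notation of `B4TorusRegionOp`: fine period `nP_ν ≥ 3`, torus region over the unit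
labels `Ω_T ⊆ Π_ν[0,P_ν)`, carrier `X = fineDom n Ω_T`; lift `X̃_R = fineDom n Ω̃_R`).
* §1 `torBond_twrap_of_nbrs` — on EVERY lattice bond `⟨p, q⟩` of `ηℤ^{d+1}` the periodic component field equals the torus
  field on the reduced bond `⟨πp, πq⟩` (`fieldLink_twrap_of_nbrs` for the link variables); `tNbr_twrap_of_nbrs` (reduction
  maps lattice bonds to torus bonds), `eq_of_nbrs_of_twrap_eq` (two lattice neighbours of a point with the same reduction
  coincide: the torus bond graph is simple).
* §2 `fld_b4Op_mulVec` — (1.3)–(1.6) AT A SITE, for orthogonal antisymmetric link variables: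
  `(HΦ)(z) = Σ_{z′}(c(z′,z) + c(z,z′))(φ(z) − W(z,z′)φ(z′)) + m²φ(z) + aΣ_{x′}(Σ_y q(y,z)q(y,x′)T(y,z)ᵀT(y,x′))φ(x′)`;
  `siteNorm_fld_regionOp_le` — `|(H^{ℤ}_{Ω}(A)Φ)(z)| ≤ (4(d+1)n² + m² + a)‖Φ‖_∞` for every lattice region and field.
* §3 `liftLabels P R Ω_T` (`Ω̃_R = {y + Pt : y ∈ Ω_T, |t|_∞ ≤ R}`), `cidx` (the copy index `⌊y/P⌋`), membership and
  block-union lemmas (`isBlockUnion_liftLabels`: `K ∣ P_ν`), the projection `proj` and the pull-back `pull u = u ∘ π`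
  (`fld_pull`, `supN_pull_le`), interior sites `IsInt` (copy index `|t|_∞ ≤ R − 1`).
* §4 THE INTERTWINING IDENTITIES: `fld_regionOp_pull` — at an interior site `(H^{ℤ}_{Ω̃_R}(A^per)(u∘π))(x̃) = (H^{T}_{Ω}(A)u)(πx̃)`;
  `fld_regionDeriv_pull` — `(D^{ℤ}_{A^per,μ}(u∘π))(x̃) = (D^{T}_{A,μ}u)(πx̃)`; `contourTrans_lift` (block transporters agree).
HONEST SCOPE.  Lattice/torus bookkeeping only (no analytic estimate); abelian one-parameter flow `F.U`; the lift is a proof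
device of ours, disclosed as such.  `def`s with bodies (`liftLabels`, `cidx`, `proj`, `pull`, `IsInt`), no `Prop`-valued
fact, no `sorry`; axioms standard.
-/

namespace Literature.MathematicalPhysics.QuantumFieldTheory.Balaban1983to89.B4TorusRegionLift

open Literature.MathematicalPhysics.QuantumFieldTheory.Balaban1983to89.B4TorusPositivity (wrap box mem_box wrap_mem_box
  wrap_eq_self_of_mem wrap_wrap_add wrap_translate)
open Literature.MathematicalPhysics.QuantumFieldTheory.Balaban1983to89.B4Reflection242 (boxDom mem_boxDom nbrs mem_nbrs
  blk blk_mem_boxDom blk_mul card_nbrs nbrs_comm)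
open Literature.MathematicalPhysics.QuantumFieldTheory.Balaban1983to89.B4GaugeCovariance
open Literature.MathematicalPhysics.QuantumFieldTheory.Balaban1983to89.B4ContourShift (supNorm supNorm_nonneg
  exists_supNorm_eq abs_le_supNorm)
open Literature.MathematicalPhysics.QuantumFieldTheory.Balaban1983to89.B4Lower18 (fineDom mem_fineDom IsBlockUnion
  fineDom_isBlockUnion)
open Literature.MathematicalPhysics.QuantumFieldTheory.Balaban1983to89.B4Lower18Regular (e1 e1_apply_self e1_apply_ne
  PathRel lsum transport_fieldLink dotProduct_self_nonneg' covOp_form fieldLink_orth stair pathRel_stair base_le_of_blk)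
open Literature.MathematicalPhysics.QuantumFieldTheory.Balaban1983to89.B4Lower18RegularRegion (regWt rBlkWt rbaseEmb
  rstairContour compField regWt_nonneg rBlkWt_nonneg rstairContour_path rstairContour_end rBlkWt_ne_zero covLap_congr
  projOp_congr covOp_congr transport_congr pathRel_mono pathRel_and pathRel_chain blk_of_between)
open Literature.MathematicalPhysics.QuantumFieldTheory.Balaban1983to89.B4Lemma21Region (regionOp regionDeriv siteNorm
  covDeriv compField_rev fieldLink_rev fld_covDeriv_mulVec_of_mem fld_covDeriv_mulVec_of_not_mem)
open Literature.MathematicalPhysics.QuantumFieldTheory.Balaban1983to89.B4Lemma22Reduce231 (supN le_supN supN_nonneg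
  supN_le siteNorm_nonneg siteNorm_zero siteNorm_smul siteNorm_add_le)
open Literature.MathematicalPhysics.QuantumFieldTheory.Balaban1983to89.B4Lemma22ReduceDeriv (siteNorm_flow)
open Literature.MathematicalPhysics.QuantumFieldTheory.Balaban1983to89.B4Lemma22ReduceZero (siteNorm_sum_le)
open Literature.MathematicalPhysics.QuantumFieldTheory.Balaban1983to89.B4CubeOpReindex (covKer covOp_eq_blockOp')
open Literature.MathematicalPhysics.QuantumFieldTheory.Balaban1983to89.B4RegionCubeCarrier (map_val_rstairContour)
open Literature.MathematicalPhysics.QuantumFieldTheory.Balaban1983to89.B4SubBoxCarrier (lsum_map mem_nbrs_add_iff)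
open Literature.MathematicalPhysics.QuantumFieldTheory.Balaban1983to89.B4Prop31Holonomy (stair_add lsum_map_add)
open Literature.MathematicalPhysics.QuantumFieldTheory.Balaban1983to89.B4TwoBox120 (blk_add_mul)
open Literature.MathematicalPhysics.QuantumFieldTheory.Balaban1983to89.B4TorusKernel.MultiPeriod (translate)
open Literature.MathematicalPhysics.QuantumFieldTheory.Balaban1983to89.B4TorusRegionOp
open scoped Matrix

noncomputable section

variable {d : ℕ}

/-! ## §1. The periodic field on lattice bonds = the torus field on reduced bonds -/

/-- `twrap(u + e_i) = twrap(u + e_μ)` only for `μ = i` (fine period `≥ 3`). [cite: Balaban1983RegularityDecay, p.572 «periodic conditions», dictionary] -/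
theorem twrap_add_e1_eq_iff {n : ℕ} {P : Fin (d + 1) → ℕ} (h3 : ∀ ν, 3 ≤ per n P ν) (u : Fin (d + 1) → ℤ)
    (i μ : Fin (d + 1)) : twrap n P (u + e1 i) = twrap n P (u + e1 μ) ↔ μ = i := by
  constructor
  · intro h
    by_contra hne
    have hd := (twrap_eq_twrap_iff n P _ _).1 h i
    simp only [Pi.add_apply, e1_apply_self, e1_apply_ne (Ne.symm hne)] at hd
    have : (u i + 1 - (u i + 0) : ℤ) = 1 := by ring
    rw [this] at hd
    exact not_dvd_of_small (h3 i) one_ne_zero (by norm_num) hd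
  · rintro rfl; rfl

/-- `twrap u ≠ twrap(u + e_i + e_μ)` (fine period `≥ 3`). [cite: Balaban1983RegularityDecay, p.572 «periodic conditions», dictionary] -/
theorem twrap_ne_twrap_add_e1_add_e1 {n : ℕ} {P : Fin (d + 1) → ℕ} (h3 : ∀ ν, 3 ≤ per n P ν) (u : Fin (d + 1) → ℤ)
    (i μ : Fin (d + 1)) : twrap n P u ≠ twrap n P (u + e1 i + e1 μ) := by
  intro h
  have hd := (twrap_eq_twrap_iff n P _ _).1 h i
  simp only [Pi.add_apply, e1_apply_self] at hd
  by_cases hμ : μ = i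
  · subst hμ
    rw [e1_apply_self] at hd
    have : (u μ - (u μ + 1 + 1) : ℤ) = -2 := by ring
    rw [this] at hd
    exact not_dvd_of_small (h3 μ) (by norm_num) (by norm_num) hd
  · rw [e1_apply_ne (Ne.symm hμ)] at hd
    have : (u i - (u i + 1 + 0) : ℤ) = -1 := by ring
    rw [this] at hd
    exact not_dvd_of_small (h3 i) (by norm_num) (by norm_num) hd

/-- **ON EVERY LATTICE BOND THE PERIODIC COMPONENT FIELD IS THE TORUS FIELD OF THE REDUCED BOND**:
`A^per(p, q) = A^T(πp, πq)` for `q = p ± e_i` (fine period `≥ 3`). [cite: Balaban1983RegularityDecay, p.572 «A_{⟨x,x+ηe_μ⟩} = A_μ(x)», «periodic conditions»] -/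
theorem torBond_twrap_of_nbrs {n : ℕ} {P : Fin (d + 1) → ℕ} (h3 : ∀ ν, 3 ≤ per n P ν)
    (Ac : (Fin (d + 1) → ℤ) → Fin (d + 1) → ℝ) {p q : Fin (d + 1) → ℤ} (hpq : q ∈ nbrs p) :
    torBond n P Ac (twrap n P p) (twrap n P q) = compField (perField n P Ac) p q := by
  have key : ∀ (p : Fin (d + 1) → ℤ) (i : Fin (d + 1)),
      torBond n P Ac (twrap n P p) (twrap n P (p + e1 i)) = compField (perField n P Ac) p (p + e1 i) := by
    intro p i
    rw [B4Lower18RegularRegion.compField_add, perField, torBond]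
    have h1 : ∀ μ, (twrap n P (p + e1 i) = twrap n P (twrap n P p + e1 μ)) ↔ μ = i := fun μ => by
      rw [twrap_twrap_add, twrap_add_e1_eq_iff h3]
    have h2 : ∀ μ, ¬ (twrap n P p = twrap n P (twrap n P (p + e1 i) + e1 μ)) := fun μ => by
      rw [twrap_twrap_add]
      exact twrap_ne_twrap_add_e1_add_e1 h3 p i μ
    simp only [h1, h2, if_false, Finset.sum_const_zero, sub_zero]
    rw [Finset.sum_ite_eq' Finset.univ i, if_pos (Finset.mem_univ _)]
  obtain ⟨i, hi | hi⟩ := mem_nbrs.1 hpq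
  · have hi' : q = p + e1 i := hi
    subst hi'
    exact key p i
  · have hi' : p = q + e1 i := by rw [hi]; simp [e1]
    subst hi'
    rw [torBond_rev, compField_rev, key q i]

variable {ι : Type} [Fintype ι] [DecidableEq ι]

/-- … hence the link variables agree: `U(κA^per(p,q)) = U(κA^T(πp,πq))` on lattice bonds.
[cite: Balaban1983RegularityDecay, (1.2) p.572] -/
theorem fieldLink_twrap_of_nbrs (F : OrthFlow ι) (κ : ℝ) {n : ℕ} {P : Fin (d + 1) → ℕ}
    (h3 : ∀ ν, 3 ≤ per n P ν) (Ac : (Fin (d + 1) → ℤ) → Fin (d + 1) → ℝ)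
    {p q : Fin (d + 1) → ℤ} (hpq : q ∈ nbrs p) :
    F.U (κ * compField (perField n P Ac) p q) = F.U (κ * torBond n P Ac (twrap n P p) (twrap n P q)) := by
  rw [torBond_twrap_of_nbrs h3 Ac hpq]

omit [Fintype ι] [DecidableEq ι] in
/-- REDUCTION MAPS LATTICE BONDS TO TORUS BONDS. [cite: Balaban1983RegularityDecay, p.572 «bonds», «periodic conditions», dictionary] -/
theorem tNbr_twrap_of_nbrs (n : ℕ) (P : Fin (d + 1) → ℕ) {p q : Fin (d + 1) → ℤ} (hpq : q ∈ nbrs p) :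
    TNbr n P (twrap n P p) (twrap n P q) := by
  obtain ⟨i, hi | hi⟩ := mem_nbrs.1 hpq
  · refine ⟨i, Or.inl ?_⟩
    have hi' : q = p + e1 i := hi
    rw [hi', twrap_twrap_add]
  · refine ⟨i, Or.inr ?_⟩
    have hi' : p = q + e1 i := by rw [hi]; simp [e1]
    rw [hi', twrap_twrap_add]

omit [Fintype ι] [DecidableEq ι] in
/-- THE TORUS BOND GRAPH IS SIMPLE (fine period `≥ 3`): two lattice neighbours of a point with the same reduction coincide.
[cite: Balaban1983RegularityDecay, p.572 «periodic conditions», dictionary] -/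
theorem eq_of_nbrs_of_twrap_eq {n : ℕ} {P : Fin (d + 1) → ℕ} (h3 : ∀ ν, 3 ≤ per n P ν) {p q q' : Fin (d + 1) → ℤ}
    (hq : q ∈ nbrs p) (hq' : q' ∈ nbrs p) (h : twrap n P q = twrap n P q') : q = q' := by
  have hd := (twrap_eq_twrap_iff n P _ _).1 h
  -- coordinates of lattice neighbours differ from those of the centre by at most one
  have hstep : ∀ {w : Fin (d + 1) → ℤ}, w ∈ nbrs p → ∀ ν, |w ν - p ν| ≤ 1 := by
    intro w hw ν
    obtain ⟨i, hi | hi⟩ := mem_nbrs.1 hw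
    · rw [hi, Pi.add_apply, add_sub_cancel_left, Pi.single_apply]
      split_ifs <;> simp
    · rw [hi, Pi.sub_apply, sub_sub_cancel_left, abs_neg, Pi.single_apply]
      split_ifs <;> simp
  -- `q − q′` has entries of absolute value ≤ 2 and is divisible by the period coordinatewise, hence zero
  funext ν
  by_contra hν
  have hν' : q ν - q' ν ≠ 0 := sub_ne_zero.2 hν
  refine not_dvd_of_small (h3 ν) hν' ?_ (hd ν)
  calc |q ν - q' ν| = |(q ν - p ν) - (q' ν - p ν)| := by ring_nf
    _ ≤ |q ν - p ν| + |q' ν - p ν| := abs_sub _ _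
    _ ≤ 1 + 1 := add_le_add (hstep hq ν) (hstep hq' ν)
    _ = 2 := by norm_num

/-! ## §2. The operator (1.6) at a site; its sup-norm size on a lattice region -/

section SiteFormula

variable {X Y : Type} [Fintype X] [Fintype Y] [DecidableEq X]

/-- the Laplacian kernel on the diagonal, applied (orthogonal links). [cite: Balaban1983RegularityDecay, (1.3) p.572, dictionary] -/
theorem covLapKer_mulVec_self (c : X → X → ℝ) (W : X → X → Matrix ι ι ℝ) (hWt : ∀ z z', (W z' z)ᵀ = W z z')
    (hWo : ∀ z z', (W z z')ᵀ * W z z' = 1) (z : X) (v : ι → ℝ) :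
    B4GaugeCovariance.covLapKer c W z z *ᵥ v = ((∑ x, c x z) + ∑ y, c z y) • v - (c z z + c z z) • (W z z *ᵥ v) := by
  rw [B4GaugeCovariance.covLapKer, if_pos rfl, if_pos rfl]
  have hWo' : ∀ x, W z x * W x z = 1 := fun x => by rw [← hWt z x]; exact hWo x z
  simp only [hWt, hWo', Matrix.sub_mulVec, Matrix.sum_mulVec, Matrix.smul_mulVec, Matrix.one_mulVec]
  rw [add_smul, add_smul, Finset.sum_smul, Finset.sum_smul]
  abel

/-- the Laplacian kernel off the diagonal, applied. [cite: Balaban1983RegularityDecay, (1.3) p.572, dictionary] -/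
theorem covLapKer_mulVec_ne (c : X → X → ℝ) (W : X → X → Matrix ι ι ℝ) (hWt : ∀ z z', (W z' z)ᵀ = W z z')
    {z z' : X} (hz : z ≠ z') (v : ι → ℝ) :
    B4GaugeCovariance.covLapKer c W z z' *ᵥ v = -((c z' z + c z z') • (W z z' *ᵥ v)) := by
  rw [B4GaugeCovariance.covLapKer, if_neg hz, if_neg hz]
  simp only [hWt, Matrix.sub_mulVec, Matrix.smul_mulVec, Matrix.zero_mulVec]
  rw [add_smul]
  abel

/-- **(1.3)–(1.6) AT A SITE** for orthogonal antisymmetric link variables (`W(z′,z)ᵀ = W(z,z′)`, `W(z,z′)ᵀW(z,z′) = 1`):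
`(HΦ)(z) = Σ_{z′}(c(z′,z) + c(z,z′))(φ(z) − W(z,z′)φ(z′)) + m²φ(z) + a·Σ_{x′}(Σ_y q(y,z)q(y,x′)T(y,z)ᵀT(y,x′))φ(x′)`.
[cite: Balaban1983RegularityDecay, (1.3)–(1.6) p.572] -/
theorem fld_covOp_mulVec (c : X → X → ℝ) (m2 a : ℝ) (q : Y → X → ℝ) (W : X → X → Matrix ι ι ℝ)
    (T : Y → X → Matrix ι ι ℝ) (hWt : ∀ z z', (W z' z)ᵀ = W z z') (hWo : ∀ z z', (W z z')ᵀ * W z z' = 1)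
    (Φ : X × ι → ℝ) (z : X) :
    fld (covOp c m2 a q W T *ᵥ Φ) z
      = (∑ z', (c z' z + c z z') • (fld Φ z - W z z' *ᵥ fld Φ z')) + m2 • fld Φ z
        + a • ∑ x', (∑ y, (q y z * q y x') • ((T y z)ᵀ * T y x')) *ᵥ fld Φ x' := by
  rw [covOp_eq_blockOp', fld_blockOp_mulVec]
  -- split the kernel into its three parts
  have hsplit : ∀ z', covKer c m2 a q W T z z' *ᵥ fld Φ z'
      = B4GaugeCovariance.covLapKer c W z z' *ᵥ fld Φ z'
        + (if z = z' then m2 • fld Φ z' else 0)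
        + a • ((∑ y, (q y z * q y z') • ((T y z)ᵀ * T y z')) *ᵥ fld Φ z') := by
    intro z'
    rw [covKer, Matrix.add_mulVec, Matrix.add_mulVec, Matrix.smul_mulVec]
    congr 2
    split_ifs
    · rw [Matrix.smul_mulVec, Matrix.one_mulVec]
    · rw [Matrix.zero_mulVec]
  -- the Laplacian part as «diagonal indicator − hopping»
  have hlap : ∀ z', B4GaugeCovariance.covLapKer c W z z' *ᵥ fld Φ z'
      = (if z = z' then (((∑ x, c x z) + ∑ y, c z y) • fld Φ z) else 0)
        - (c z' z + c z z') • (W z z' *ᵥ fld Φ z') := by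
    intro z'
    by_cases hz : z = z'
    · subst hz
      rw [if_pos rfl, covLapKer_mulVec_self c W hWt hWo]
    · rw [if_neg hz, covLapKer_mulVec_ne c W hWt hz, zero_sub]
  simp_rw [hsplit, hlap]
  rw [Finset.sum_add_distrib, Finset.sum_add_distrib, Finset.sum_sub_distrib, ← Finset.smul_sum,
    Finset.sum_ite_eq Finset.univ z, if_pos (Finset.mem_univ _), Finset.sum_ite_eq Finset.univ z,
    if_pos (Finset.mem_univ _)]
  have hsum : (((∑ x, c x z) + ∑ y, c z y) • fld Φ z : ι → ℝ) = ∑ z', (c z' z + c z z') • fld Φ z := by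
    rw [← Finset.sum_add_distrib, Finset.sum_smul]
  rw [hsum, ← Finset.sum_sub_distrib]
  simp only [smul_sub]

end SiteFormula

/-- the norm of a flow-transported vector. [cite: Balaban1983RegularityDecay, (1.2) p.572, dictionary] -/
theorem siteNorm_fieldLink_mulVec (F : OrthFlow ι) {X : Type} (κ : ℝ) (B : X → X → ℝ) (x y : X) (v : ι → ℝ) :
    siteNorm (fieldLink F κ B x y *ᵥ v) = siteNorm v :=
  siteNorm_flow F _ v

section SupBound

variable {n : ℕ} (hn : 1 ≤ n) (F : OrthFlow ι) (e : ℝ) {a m2 : ℝ} (ha : 0 ≤ a) (hm : 0 ≤ m2)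
  (Ωc : Finset (Fin (d + 1) → ℤ)) (Ac : (Fin (d + 1) → ℤ) → Fin (d + 1) → ℝ)

omit [Fintype ι] [DecidableEq ι] in
include hn in
/-- the total Neumann bond weight at a site is at most `(d+1)n²`. [cite: Balaban1983RegularityDecay, (1.3) p.572, dictionary] -/
theorem sum_regWt_le (z : ↥(fineDom n Ωc)) : ∑ z', regWt n (fineDom n Ωc) z z' ≤ (d + 1) * (n : ℝ) ^ 2 := by
  classical
  have h1 : ∑ z', regWt n (fineDom n Ωc) z z'
      = (n : ℝ) ^ 2 / 2 * ((Finset.univ.filter fun z' : ↥(fineDom n Ωc) => z'.1 ∈ nbrs z.1).card : ℝ) := by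
    rw [Finset.card_eq_sum_ones, Nat.cast_sum, Finset.mul_sum, Finset.sum_filter]
    refine Finset.sum_congr rfl fun z' _ => ?_
    unfold regWt; split_ifs <;> simp
  have h2 : ((Finset.univ.filter fun z' : ↥(fineDom n Ωc) => z'.1 ∈ nbrs z.1).card : ℝ) ≤ 2 * (d + 1) := by
    have hc : (Finset.univ.filter fun z' : ↥(fineDom n Ωc) => z'.1 ∈ nbrs z.1).card ≤ (nbrs z.1).card := by
      rw [← Finset.card_image_of_injective _ Subtype.val_injective]
      exact Finset.card_le_card fun w hw => by
        obtain ⟨z', hz', rfl⟩ := Finset.mem_image.1 hw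
        exact (Finset.mem_filter.1 hz').2
    rw [card_nbrs] at hc
    exact_mod_cast hc
  rw [h1]
  have hn' : (0 : ℝ) ≤ (n : ℝ) ^ 2 / 2 := by positivity
  nlinarith

omit [Fintype ι] [DecidableEq ι] in
/-- the symmetric Neumann weights. [cite: Balaban1983RegularityDecay, (1.3) p.572, dictionary] -/
theorem regWt_symm (z z' : ↥(fineDom n Ωc)) : regWt n (fineDom n Ωc) z' z = regWt n (fineDom n Ωc) z z' := by
  unfold regWt
  by_cases h : z.1 ∈ nbrs z'.1
  · rw [if_pos h, if_pos (nbrs_comm.1 h)]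
  · rw [if_neg h, if_neg (fun h' => h (nbrs_comm.1 h'))]

omit [Fintype ι] [DecidableEq ι] in
include hn in
/-- a unit block of the fine region has `n^{d+1}` sites. [cite: Balaban1983RegularityDecay, (1.1) p.572, dictionary] -/
theorem card_block_le (z : ↥(fineDom n Ωc)) :
    ((Finset.univ.filter fun x' : ↥(fineDom n Ωc) => blk n x'.1 = blk n z.1).card : ℝ) ≤ (n : ℝ) ^ (d + 1) := by
  classical
  -- inject the block into `Fin n`-offsets
  have hn0 : (0 : ℤ) < n := by exact_mod_cast hn
  let off : ↥(fineDom n Ωc) → (Fin (d + 1) → Fin n) := fun x' ν =>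
    ⟨(x'.1 ν % (n : ℤ)).toNat, by
      have h0 := Int.emod_nonneg (x'.1 ν) hn0.ne'
      have h1 := Int.emod_lt_of_pos (x'.1 ν) hn0
      omega⟩
  have hinj : Set.InjOn off ↑(Finset.univ.filter fun x' : ↥(fineDom n Ωc) => blk n x'.1 = blk n z.1) := by
    intro x₁ hx₁ x₂ hx₂ h
    have hb₁ := (Finset.mem_filter.1 (Finset.mem_coe.1 hx₁)).2
    have hb₂ := (Finset.mem_filter.1 (Finset.mem_coe.1 hx₂)).2
    apply Subtype.ext
    funext ν
    have hq : x₁.1 ν / (n : ℤ) = x₂.1 ν / (n : ℤ) := by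
      have := congrFun (hb₁.trans hb₂.symm) ν; exact this
    have hr : x₁.1 ν % (n : ℤ) = x₂.1 ν % (n : ℤ) := by
      have := congrArg (fun f : Fin (d + 1) → Fin n => ((f ν : ℕ) : ℤ)) h
      simp only [off] at this
      rwa [Int.toNat_of_nonneg (Int.emod_nonneg _ hn0.ne'), Int.toNat_of_nonneg (Int.emod_nonneg _ hn0.ne')] at this
    rw [← Int.mul_ediv_add_emod (x₁.1 ν) n, ← Int.mul_ediv_add_emod (x₂.1 ν) n, hq, hr]
  have hc := Finset.card_le_card_of_injOn off (fun _ _ => Finset.mem_coe.2 (Finset.mem_univ _)) hinj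
  rw [Finset.card_univ, Fintype.card_fun, Fintype.card_fin, Fintype.card_fin] at hc
  exact_mod_cast hc

include hn ha hm in
/-- **THE SUP-NORM SIZE OF (1.6) ON A LATTICE REGION**: `|(H^{ℤ}_{Ω}(A)Φ)(z)| ≤ (4(d+1)n² + m² + a)‖Φ‖_∞` for every finite
union of unit blocks, every field, every site (`a, m² ≥ 0`). [cite: Balaban1983RegularityDecay, (1.3)–(1.6) p.572] -/
theorem siteNorm_fld_regionOp_le (Φ : ↥(fineDom n Ωc) × ι → ℝ) (z : ↥(fineDom n Ωc)) :
    siteNorm (fld (regionOp F e hn a m2 Ωc Ac *ᵥ Φ) z) ≤ (4 * (d + 1) * (n : ℝ) ^ 2 + m2 + a) * supN Φ := by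
  classical
  have hn' : (0 : ℝ) < n := by exact_mod_cast hn
  set W := fieldLink F (e / n) (fun u v : ↥(fineDom n Ωc) => compField Ac u.1 v.1) with hW
  set T := contourTrans W (rbaseEmb hn Ωc) (rstairContour hn Ωc) with hT
  have hWt : ∀ z z' : ↥(fineDom n Ωc), (W z' z)ᵀ = W z z' := fun z z' => by
    have h' := fieldLink_rev F (e / n) (A := fun u v : ↥(fineDom n Ωc) => compField Ac u.1 v.1) (x := z)
      (y := z') (compField_rev Ac z.1 z'.1)
    rw [hW, h', Matrix.transpose_transpose]
  have hWo : ∀ z z' : ↥(fineDom n Ωc), (W z z')ᵀ * W z z' = 1 := fun z z' => fieldLink_orth F _ _ z z'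
  rw [regionOp, b4Op, ← hW, ← hT, fld_covOp_mulVec _ _ _ _ W T hWt hWo]
  have hS := supN_nonneg Φ
  -- Laplacian part
  have h1 : siteNorm (∑ z', (regWt n (fineDom n Ωc) z' z + regWt n (fineDom n Ωc) z z') • (fld Φ z - W z z' *ᵥ fld Φ z'))
      ≤ 4 * (d + 1) * (n : ℝ) ^ 2 * supN Φ := by
    have hterm : ∀ z', siteNorm ((regWt n (fineDom n Ωc) z' z + regWt n (fineDom n Ωc) z z') • (fld Φ z - W z z' *ᵥ fld Φ z'))
        ≤ regWt n (fineDom n Ωc) z z' * (4 * supN Φ) := by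
      intro z'
      have hw0 := regWt_nonneg n (fineDom n Ωc) z z'
      rw [regWt_symm Ωc z z', ← two_mul, siteNorm_smul, abs_of_nonneg (by positivity)]
      have hsub : siteNorm (fld Φ z - W z z' *ᵥ fld Φ z') ≤ 2 * supN Φ := by
        calc siteNorm (fld Φ z - W z z' *ᵥ fld Φ z')
            ≤ siteNorm (fld Φ z) + siteNorm (-(W z z' *ᵥ fld Φ z')) := by
              rw [sub_eq_add_neg]; exact siteNorm_add_le _ _
          _ = siteNorm (fld Φ z) + siteNorm (W z z' *ᵥ fld Φ z') := by
              rw [show -(W z z' *ᵥ fld Φ z') = (-1 : ℝ) • (W z z' *ᵥ fld Φ z') by simp, siteNorm_smul]; simp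
          _ ≤ supN Φ + supN Φ := add_le_add (le_supN Φ z) (by rw [hW, siteNorm_fieldLink_mulVec]; exact le_supN Φ z')
          _ = 2 * supN Φ := by ring
      calc 2 * regWt n (fineDom n Ωc) z z' * siteNorm (fld Φ z - W z z' *ᵥ fld Φ z')
          ≤ 2 * regWt n (fineDom n Ωc) z z' * (2 * supN Φ) :=
            mul_le_mul_of_nonneg_left hsub (by positivity)
        _ = regWt n (fineDom n Ωc) z z' * (4 * supN Φ) := by ring
    calc siteNorm (∑ z', (regWt n (fineDom n Ωc) z' z + regWt n (fineDom n Ωc) z z') • (fld Φ z - W z z' *ᵥ fld Φ z'))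
        ≤ ∑ z', siteNorm ((regWt n (fineDom n Ωc) z' z + regWt n (fineDom n Ωc) z z') • (fld Φ z - W z z' *ᵥ fld Φ z')) :=
          siteNorm_sum_le _ _
      _ ≤ ∑ z', regWt n (fineDom n Ωc) z z' * (4 * supN Φ) := Finset.sum_le_sum fun z' _ => hterm z'
      _ = (∑ z', regWt n (fineDom n Ωc) z z') * (4 * supN Φ) := by rw [Finset.sum_mul]
      _ ≤ (d + 1) * (n : ℝ) ^ 2 * (4 * supN Φ) := mul_le_mul_of_nonneg_right (sum_regWt_le hn Ωc z) (by positivity)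
      _ = 4 * (d + 1) * (n : ℝ) ^ 2 * supN Φ := by ring
  -- mass part
  have h2 : siteNorm (m2 • fld Φ z) ≤ m2 * supN Φ := by
    rw [siteNorm_smul, abs_of_nonneg hm]; exact mul_le_mul_of_nonneg_left (le_supN Φ z) hm
  -- block part
  have h3 : siteNorm ((a * ((n : ℝ) ^ (d + 1))⁻¹) •
        ∑ x', (∑ y, (rBlkWt n Ωc (fineDom n Ωc) y z * rBlkWt n Ωc (fineDom n Ωc) y x') • ((T y z)ᵀ * T y x')) *ᵥ fld Φ x')
      ≤ a * supN Φ := by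
    set y₀ : ↥Ωc := ⟨blk n z.1, (mem_fineDom hn).1 z.2⟩ with hy₀
    have hinner : ∀ x', (∑ y, (rBlkWt n Ωc (fineDom n Ωc) y z * rBlkWt n Ωc (fineDom n Ωc) y x') • ((T y z)ᵀ * T y x'))
        = (if blk n x'.1 = blk n z.1 then 1 else 0 : ℝ) • ((T y₀ z)ᵀ * T y₀ x') := by
      intro x'
      rw [Finset.sum_eq_single y₀]
      · congr 1
        simp only [rBlkWt, hy₀]
        by_cases hx : blk n x'.1 = blk n z.1
        · simp [hx]
        · simp [hx]
      · intro y _ hy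
        have : rBlkWt n Ωc (fineDom n Ωc) y z = 0 := by
          simp only [rBlkWt]
          rw [if_neg]
          intro hb; exact hy (Subtype.ext hb.symm)
        rw [this, zero_mul, zero_smul]
      · intro h; exact absurd (Finset.mem_univ _) h
    simp_rw [hinner]
    rw [siteNorm_smul, abs_of_nonneg (by positivity)]
    have hterm : ∀ x', siteNorm (((if blk n x'.1 = blk n z.1 then 1 else 0 : ℝ) • ((T y₀ z)ᵀ * T y₀ x')) *ᵥ fld Φ x')
        ≤ (if blk n x'.1 = blk n z.1 then 1 else 0 : ℝ) * supN Φ := by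
      intro x'
      split_ifs with hx
      · rw [one_smul, one_mul, ← Matrix.mulVec_mulVec, hT, contourTrans, contourTrans, transport_fieldLink,
          transport_fieldLink, F.transpose_eq, siteNorm_flow, siteNorm_flow]
        exact le_supN Φ x'
      · rw [zero_smul, Matrix.zero_mulVec, siteNorm_zero, zero_mul]
    calc a * ((n : ℝ) ^ (d + 1))⁻¹ *
          siteNorm (∑ x', ((if blk n x'.1 = blk n z.1 then 1 else 0 : ℝ) • ((T y₀ z)ᵀ * T y₀ x')) *ᵥ fld Φ x')
        ≤ a * ((n : ℝ) ^ (d + 1))⁻¹ * ∑ x' : ↥(fineDom n Ωc), (if blk n x'.1 = blk n z.1 then 1 else 0 : ℝ) * supN Φ := by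
          refine mul_le_mul_of_nonneg_left ?_ (by positivity)
          exact (siteNorm_sum_le _ _).trans (Finset.sum_le_sum fun x' _ => hterm x')
      _ = a * ((n : ℝ) ^ (d + 1))⁻¹ *
          (((Finset.univ.filter fun x' : ↥(fineDom n Ωc) => blk n x'.1 = blk n z.1).card : ℝ) * supN Φ) := by
          rw [← Finset.sum_mul, Finset.sum_boole]
      _ ≤ a * ((n : ℝ) ^ (d + 1))⁻¹ * ((n : ℝ) ^ (d + 1) * supN Φ) := by
          refine mul_le_mul_of_nonneg_left ?_ (by positivity)
          exact mul_le_mul_of_nonneg_right (card_block_le hn Ωc z) hS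
      _ = a * supN Φ := by field_simp
  calc siteNorm ((∑ z', (regWt n (fineDom n Ωc) z' z + regWt n (fineDom n Ωc) z z') • (fld Φ z - W z z' *ᵥ fld Φ z'))
          + m2 • fld Φ z
          + (a * ((n : ℝ) ^ (d + 1))⁻¹) •
            ∑ x', (∑ y, (rBlkWt n Ωc (fineDom n Ωc) y z * rBlkWt n Ωc (fineDom n Ωc) y x') • ((T y z)ᵀ * T y x'))
              *ᵥ fld Φ x')
      ≤ siteNorm ((∑ z', (regWt n (fineDom n Ωc) z' z + regWt n (fineDom n Ωc) z z') • (fld Φ z - W z z' *ᵥ fld Φ z'))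
            + m2 • fld Φ z)
          + siteNorm ((a * ((n : ℝ) ^ (d + 1))⁻¹) •
            ∑ x', (∑ y, (rBlkWt n Ωc (fineDom n Ωc) y z * rBlkWt n Ωc (fineDom n Ωc) y x') • ((T y z)ᵀ * T y x'))
              *ᵥ fld Φ x') := siteNorm_add_le _ _
    _ ≤ (4 * (d + 1) * (n : ℝ) ^ 2 * supN Φ + m2 * supN Φ) + a * supN Φ :=
          add_le_add ((siteNorm_add_le _ _).trans (add_le_add h1 h2)) h3
    _ = (4 * (d + 1) * (n : ℝ) ^ 2 + m2 + a) * supN Φ := by ring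

end SupBound

/-! ## §3. The periodic lift `Ω̃_R`: copies of the period box, the projection, the pull-back -/

/-- the COPY INDEX of a unit label: `⌊y_ν / P_ν⌋` (which translate of the period box contains `y`).
[cite: Balaban1983RegularityDecay, p.572 «periodic conditions», dictionary] -/
def cidx (P : Fin (d + 1) → ℕ) (y : Fin (d + 1) → ℤ) : Fin (d + 1) → ℤ := fun ν => y ν / (P ν : ℤ)

omit [Fintype ι] [DecidableEq ι] in
/-- a label is its representative plus `P` times its copy index. [cite: Balaban1983RegularityDecay, p.572 «periodic conditions», dictionary] -/
theorem eq_wrap_add_cidx (P : Fin (d + 1) → ℕ) (y : Fin (d + 1) → ℤ) :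
    y = wrap P y + fun ν => (P ν : ℤ) * cidx P y ν := by
  funext ν
  simp only [wrap, cidx, Pi.add_apply]
  linarith [Int.mul_ediv_add_emod (y ν) (P ν : ℤ)]

omit [Fintype ι] [DecidableEq ι] in
/-- the copy index of a translate by `P t` shifts by `t`; the representative does not change.
[cite: Balaban1983RegularityDecay, p.572 «periodic conditions», dictionary] -/
theorem cidx_add_mul {P : Fin (d + 1) → ℕ} (hP : ∀ ν, 1 ≤ P ν) (y t : Fin (d + 1) → ℤ) :
    cidx P (y + fun ν => (P ν : ℤ) * t ν) = cidx P y + t := by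
  funext ν
  have hP0 : (P ν : ℤ) ≠ 0 := by have := hP ν; omega
  simp only [cidx, Pi.add_apply]
  rw [Int.add_mul_ediv_left _ _ hP0]

omit [Fintype ι] [DecidableEq ι] in
/-- labels of the period box have copy index `0`. [cite: Balaban1983RegularityDecay, p.572 «periodic conditions», dictionary] -/
theorem cidx_of_mem_boxDom {P : Fin (d + 1) → ℕ} {y : Fin (d + 1) → ℤ} (hy : y ∈ boxDom P) : cidx P y = 0 := by
  funext ν
  exact Int.ediv_eq_zero_of_lt (mem_boxDom.1 hy ν).1 (mem_boxDom.1 hy ν).2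

/-- **THE LIFTED LABEL SET** `Ω̃_R = {y + Pt : y ∈ Ω_T, |t|_∞ ≤ R}`: the `(2R+1)^{d+1}` translated copies of the torus
region's unit labels. [cite: Balaban1983RegularityDecay, p.572 «a rectangular parallelepiped in ηZ^d with periodic conditions», dictionary] -/
def liftLabels (P : Fin (d + 1) → ℕ) (R : ℕ) (ΩT : Finset (Fin (d + 1) → ℤ)) : Finset (Fin (d + 1) → ℤ) :=
  (ΩT ×ˢ Fintype.piFinset fun _ : Fin (d + 1) => Finset.Icc (-(R : ℤ)) R).image
    fun p => p.1 + fun ν => (P ν : ℤ) * p.2 ν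

omit [Fintype ι] [DecidableEq ι] in
/-- membership in the lift: the representative lies in `Ω_T` and the copy index is at most `R`.
[cite: Balaban1983RegularityDecay, p.572 «periodic conditions», dictionary] -/
theorem mem_liftLabels_iff {P : Fin (d + 1) → ℕ} (hP : ∀ ν, 1 ≤ P ν) {ΩT : Finset (Fin (d + 1) → ℤ)}
    (hΩ : ΩT ⊆ boxDom P) {R : ℕ} {y : Fin (d + 1) → ℤ} :
    y ∈ liftLabels P R ΩT ↔ wrap P y ∈ ΩT ∧ ∀ ν, |cidx P y ν| ≤ R := by
  constructor
  · intro h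
    obtain ⟨⟨y₀, t⟩, hp, rfl⟩ := Finset.mem_image.1 h
    obtain ⟨hy₀, ht⟩ := Finset.mem_product.1 hp
    have ht' : ∀ ν, |t ν| ≤ R := fun ν => abs_le.2 (Finset.mem_Icc.1 (Fintype.mem_piFinset.1 ht ν))
    have hw : wrap P (y₀ + fun ν => (P ν : ℤ) * t ν) = y₀ := by
      have : (y₀ + fun ν => (P ν : ℤ) * t ν) = translate P y₀ t := by funext ν; rfl
      rw [this, wrap_translate, wrap_eq_self_of_mem (by rw [box_eq_boxDom]; exact hΩ hy₀)]
    refine ⟨by rw [hw]; exact hy₀, fun ν => ?_⟩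
    rw [cidx_add_mul hP, cidx_of_mem_boxDom (hΩ hy₀), zero_add]
    exact ht' ν
  · rintro ⟨hw, ht⟩
    refine Finset.mem_image.2 ⟨⟨wrap P y, cidx P y⟩, Finset.mem_product.2 ⟨hw, ?_⟩, (eq_wrap_add_cidx P y).symm⟩
    exact Fintype.mem_piFinset.2 fun ν => Finset.mem_Icc.2 (abs_le.1 (ht ν))

omit [Fintype ι] [DecidableEq ι] in
/-- fine sites of the lift: the reduction lies in the torus region and the block's copy index is at most `R`.
[cite: Balaban1983RegularityDecay, (1.1) p.572, dictionary] -/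
theorem mem_fineDom_lift_iff {n : ℕ} (hn : 1 ≤ n) {P : Fin (d + 1) → ℕ} (hP : ∀ ν, 1 ≤ P ν)
    {ΩT : Finset (Fin (d + 1) → ℤ)} (hΩ : ΩT ⊆ boxDom P) {R : ℕ} {x : Fin (d + 1) → ℤ} :
    x ∈ fineDom n (liftLabels P R ΩT) ↔ twrap n P x ∈ fineDom n ΩT ∧ ∀ ν, |cidx P (blk n x) ν| ≤ R := by
  rw [mem_fineDom hn, mem_fineDom hn, blk_twrap hn, mem_liftLabels_iff hP hΩ]

omit [Fintype ι] [DecidableEq ι] in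
/-- blocks of size `K ∣ P_ν` translate under `P t`. [cite: Balaban1983RegularityDecay, (1.1) p.572, dictionary] -/
theorem blk_add_mul_of_dvd {K : ℕ} (hK : 1 ≤ K) {P : Fin (d + 1) → ℕ} (hKP : ∀ ν, K ∣ P ν) (w t : Fin (d + 1) → ℤ) :
    blk K (w + fun ν => (P ν : ℤ) * t ν) = blk K w + fun ν => ((P ν / K : ℕ) : ℤ) * t ν := by
  have h : (fun ν => (P ν : ℤ) * t ν) = fun ν => (K : ℤ) * (((P ν / K : ℕ) : ℤ) * t ν) := by
    funext ν
    obtain ⟨c, hc⟩ := hKP ν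
    rw [hc, Nat.mul_div_cancel_left c (by omega)]
    push_cast; ring
  rw [h, blk_add_mul hK]

omit [Fintype ι] [DecidableEq ι] in
/-- **THE LIFT OF A UNION OF BIG BLOCKS IS A UNION OF BIG BLOCKS** (`K ∣ P_ν`).
[cite: Balaban1983RegularityDecay, p.572 «Ω … unions of big blocks», dictionary] -/
theorem isBlockUnion_liftLabels {K : ℕ} (hK : 1 ≤ K) {P : Fin (d + 1) → ℕ}
    (hKP : ∀ ν, K ∣ P ν) {ΩT : Finset (Fin (d + 1) → ℤ)} (hΩK : IsBlockUnion K ΩT) (R : ℕ) :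
    IsBlockUnion K (liftLabels P R ΩT) := by
  intro x hx z hz
  obtain ⟨⟨y₀, t⟩, hp, rfl⟩ := Finset.mem_image.1 hx
  obtain ⟨hy₀, ht⟩ := Finset.mem_product.1 hp
  -- translate `z` back to the period box copy
  set z₀ : Fin (d + 1) → ℤ := z - fun ν => (P ν : ℤ) * t ν with hz₀
  have hz' : z = z₀ + fun ν => (P ν : ℤ) * t ν := by rw [hz₀]; abel
  have hblk : blk K z₀ = blk K y₀ := by
    have h1 := blk_add_mul_of_dvd hK hKP z₀ t
    have h2 := blk_add_mul_of_dvd hK hKP y₀ t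
    rw [← hz'] at h1
    have : blk K z₀ + (fun ν => ((P ν / K : ℕ) : ℤ) * t ν) = blk K y₀ + fun ν => ((P ν / K : ℕ) : ℤ) * t ν := by
      rw [← h1, ← h2, hz]
    exact add_right_cancel this
  have hz₀mem : z₀ ∈ ΩT := hΩK hy₀ hblk
  rw [hz']
  exact Finset.mem_image.2 ⟨⟨z₀, t⟩, Finset.mem_product.2 ⟨hz₀mem, ht⟩, rfl⟩

omit [Fintype ι] [DecidableEq ι] in
/-- the period box copy (`t = 0`) lies in every lift. [cite: Balaban1983RegularityDecay, p.572 «periodic conditions», dictionary] -/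
theorem subset_liftLabels {P : Fin (d + 1) → ℕ} (R : ℕ) (ΩT : Finset (Fin (d + 1) → ℤ)) : ΩT ⊆ liftLabels P R ΩT := by
  intro y hy
  refine Finset.mem_image.2 ⟨⟨y, 0⟩, Finset.mem_product.2 ⟨hy, ?_⟩, ?_⟩
  · exact Fintype.mem_piFinset.2 fun ν => Finset.mem_Icc.2 ⟨by simp, by simp⟩
  · funext ν; simp

omit [Fintype ι] [DecidableEq ι] in
/-- the lift is monotone in the label set. [cite: Balaban1983RegularityDecay, p.572 «periodic conditions», dictionary] -/
theorem liftLabels_mono {P : Fin (d + 1) → ℕ} (R : ℕ) {ΩT Ω₀T : Finset (Fin (d + 1) → ℤ)} (h : ΩT ⊆ Ω₀T) :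
    liftLabels P R ΩT ⊆ liftLabels P R Ω₀T := by
  intro y hy
  obtain ⟨p, hp, rfl⟩ := Finset.mem_image.1 hy
  obtain ⟨h1, h2⟩ := Finset.mem_product.1 hp
  exact Finset.mem_image.2 ⟨p, Finset.mem_product.2 ⟨h h1, h2⟩, rfl⟩

section Lift

variable {n : ℕ} (hn : 1 ≤ n) {P : Fin (d + 1) → ℕ} (hP : ∀ ν, 1 ≤ P ν) {ΩT : Finset (Fin (d + 1) → ℤ)}
  (hΩ : ΩT ⊆ boxDom P) (R : ℕ)

/-- **THE PROJECTION** `π : Ω̃_R → Ω` (reduction of representatives). [cite: Balaban1983RegularityDecay, p.572 «periodic conditions», dictionary] -/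
def proj (x : ↥(fineDom n (liftLabels P R ΩT))) : ↥(fineDom n ΩT) :=
  ⟨twrap n P x.1, ((mem_fineDom_lift_iff hn hP hΩ).1 x.2).1⟩

omit [Fintype ι] [DecidableEq ι] in
/-- the underlying point of the projection. [cite: Balaban1983RegularityDecay, p.572, dictionary] -/
theorem proj_val (x : ↥(fineDom n (liftLabels P R ΩT))) : (proj hn hP hΩ R x).1 = twrap n P x.1 := rfl

/-- **THE PULL-BACK** `u ∘ π` of a field on the torus region to the lift (the periodic extension, restricted to `Ω̃_R`).
[cite: Balaban1983RegularityDecay, p.572 «periodic conditions», dictionary] -/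
def pull (u : ↥(fineDom n ΩT) × ι → ℝ) : ↥(fineDom n (liftLabels P R ΩT)) × ι → ℝ :=
  fun p => u (proj hn hP hΩ R p.1, p.2)

omit [Fintype ι] [DecidableEq ι] in
/-- the pull-back at a site. [cite: Balaban1983RegularityDecay, p.572, dictionary] -/
theorem fld_pull (u : ↥(fineDom n ΩT) × ι → ℝ) (x : ↥(fineDom n (liftLabels P R ΩT))) :
    fld (pull hn hP hΩ R u) x = fld u (proj hn hP hΩ R x) := rfl

omit [DecidableEq ι] in
/-- the pull-back does not increase the sup norm. [cite: Balaban1983RegularityDecay, (1.9) p.573 «‖f‖_∞», dictionary] -/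
theorem supN_pull_le (u : ↥(fineDom n ΩT) × ι → ℝ) : supN (pull hn hP hΩ R u) ≤ supN u :=
  supN_le (supN_nonneg u) fun x => by rw [fld_pull]; exact le_supN u _

omit [Fintype ι] [DecidableEq ι] in
/-- the pull-back is additive. [cite: Balaban1983RegularityDecay, p.572, dictionary] -/
theorem pull_add (u v : ↥(fineDom n ΩT) × ι → ℝ) :
    pull hn hP hΩ R (u + v) = pull hn hP hΩ R u + pull hn hP hΩ R v := rfl

omit [Fintype ι] [DecidableEq ι] in
/-- the pull-back is compatible with subtraction. [cite: Balaban1983RegularityDecay, p.572, dictionary] -/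
theorem pull_sub (u v : ↥(fineDom n ΩT) × ι → ℝ) :
    pull hn hP hΩ R (u - v) = pull hn hP hΩ R u - pull hn hP hΩ R v := rfl

/-- INTERIOR SITES of the lift: the block's copy index is at most `R − 1` in every direction (all wrapped neighbours
then have lifts inside `Ω̃_R`). [cite: Balaban1983RegularityDecay, p.572 «periodic conditions», dictionary] -/
def IsInt (n : ℕ) (P : Fin (d + 1) → ℕ) (R : ℕ) (x : Fin (d + 1) → ℤ) : Prop :=
  ∀ ν, |cidx P (blk n x) ν| + 1 ≤ R

omit [Fintype ι] [DecidableEq ι] in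
/-- integer division by a positive number is `1`-Lipschitz on consecutive integers. [cite: Balaban1983RegularityDecay, (1.1) p.572, dictionary] -/
theorem abs_ediv_sub_ediv_le {p : ℤ} (hp : 0 < p) {a b : ℤ} (h : |a - b| ≤ 1) : |a / p - b / p| ≤ 1 := by
  have key : ∀ {a b : ℤ}, a ≤ b + 1 → a / p ≤ b / p + 1 := by
    intro a b hab
    calc a / p ≤ (b + 1) / p := Int.ediv_le_ediv hp hab
      _ ≤ (b + p * 1) / p := Int.ediv_le_ediv hp (by linarith)
      _ = b / p + 1 := by rw [Int.add_mul_ediv_left _ _ hp.ne']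
  rw [abs_le] at h ⊢
  constructor
  · have := key (a := b) (b := a) (by linarith); linarith
  · have := key (a := a) (b := b) (by linarith); linarith

omit [Fintype ι] [DecidableEq ι] in
/-- the block label of a lattice neighbour differs by at most one in each coordinate. [cite: Balaban1983RegularityDecay, (1.1) p.572, dictionary] -/
theorem abs_blk_sub_blk_le_of_nbrs (hn : 1 ≤ n) {x z : Fin (d + 1) → ℤ} (hz : z ∈ nbrs x) (ν : Fin (d + 1)) :
    |blk n z ν - blk n x ν| ≤ 1 := by
  have hn0 : (0 : ℤ) < n := by exact_mod_cast hn
  refine abs_ediv_sub_ediv_le hn0 ?_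
  obtain ⟨i, hi | hi⟩ := mem_nbrs.1 hz
  · rw [hi, Pi.add_apply, add_sub_cancel_left, Pi.single_apply]; split_ifs <;> simp
  · rw [hi, Pi.sub_apply, sub_sub_cancel_left, abs_neg, Pi.single_apply]; split_ifs <;> simp

omit [Fintype ι] [DecidableEq ι] in
include hn hP hΩ in
/-- **AT AN INTERIOR SITE EVERY WRAPPED NEIGHBOUR LIFTS**: a lattice neighbour of an interior site of the lift whose
reduction lies in the torus region is itself a site of the lift. [cite: Balaban1983RegularityDecay, p.572 «periodic conditions», dictionary] -/
theorem nbr_mem_lift {x z : Fin (d + 1) → ℤ} (hint : IsInt n P R x) (hz : z ∈ nbrs x)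
    (hzT : twrap n P z ∈ fineDom n ΩT) : z ∈ fineDom n (liftLabels P R ΩT) := by
  rw [mem_fineDom_lift_iff hn hP hΩ]
  refine ⟨hzT, fun ν => ?_⟩
  have h1 : |blk n z ν - blk n x ν| ≤ 1 := abs_blk_sub_blk_le_of_nbrs hn hz ν
  have hP0 : (0 : ℤ) < (P ν : ℤ) := by exact_mod_cast hP ν
  have h2 : |cidx P (blk n z) ν - cidx P (blk n x) ν| ≤ 1 := abs_ediv_sub_ediv_le hP0 h1
  have h3 := hint ν
  have h4 : |cidx P (blk n z) ν| ≤ |cidx P (blk n x) ν| + |cidx P (blk n z) ν - cidx P (blk n x) ν| := by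
    have := abs_add_le (cidx P (blk n x) ν) (cidx P (blk n z) ν - cidx P (blk n x) ν)
    rwa [add_sub_cancel] at this
  have : (|cidx P (blk n z) ν| : ℤ) ≤ R := by linarith
  exact_mod_cast this

omit [Fintype ι] [DecidableEq ι] in
include hn hP hΩ in
/-- sites of the period box copy belong to the lift. [cite: Balaban1983RegularityDecay, p.572 «periodic conditions», dictionary] -/
theorem mem_lift_of_mem {x : Fin (d + 1) → ℤ} (hx : x ∈ fineDom n ΩT) : x ∈ fineDom n (liftLabels P R ΩT) := by
  rw [mem_fineDom_lift_iff hn hP hΩ]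
  have hb : blk n x ∈ boxDom P := hΩ ((mem_fineDom hn).1 hx)
  refine ⟨?_, fun ν => ?_⟩
  · rwa [twrap_eq_self (val_mem_perBox hn hΩ ⟨x, hx⟩)]
  · rw [cidx_of_mem_boxDom hb]; simp

end Lift

/-! ## §4. The intertwining identities -/

omit [Fintype ι] [DecidableEq ι] in
/-- bond sums along an `r`-path of two bond functions agreeing on `r`-pairs coincide. [cite: Balaban1983RegularityDecay, p.572 «A(Γ) = Σ_{b⊂Γ} A_b», dictionary] -/
theorem lsum_congr_rel {X : Type*} {r : X → X → Prop} {B B' : X → X → ℝ} (h : ∀ u v, r u v → B u v = B' u v) :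
    ∀ (x : X) (l : List X), PathRel r x l → lsum B x l = lsum B' x l
  | _, [], _ => rfl
  | x, y :: l, hp => by
      have hp' : r x y ∧ PathRel r y l := hp
      rw [lsum, lsum, h x y hp'.1, lsum_congr_rel h y l hp'.2]

/-- the PERIOD SHIFT OF A BLOCK with label `ỹ`: `n·(wrap_P ỹ − ỹ)` (a period vector). [cite: Balaban1983RegularityDecay, (1.1) p.572, dictionary] -/
def bshift (n : ℕ) (P : Fin (d + 1) → ℕ) (yb : Fin (d + 1) → ℤ) : Fin (d + 1) → ℤ :=
  fun ν => (n : ℤ) * (wrap P yb ν - yb ν)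

omit [Fintype ι] [DecidableEq ι] in
/-- the block shift is a period vector. [cite: Balaban1983RegularityDecay, p.572 «periodic conditions», dictionary] -/
theorem bshift_eq_per_mul (n : ℕ) (P : Fin (d + 1) → ℕ) (yb : Fin (d + 1) → ℤ) :
    bshift n P yb = fun ν => (per n P ν : ℤ) * (-cidx P yb ν) := by
  funext ν
  simp only [bshift, per, wrap, cidx, Nat.cast_mul]
  linear_combination (n : ℤ) * Int.mul_ediv_add_emod (yb ν) (P ν : ℤ)

omit [Fintype ι] [DecidableEq ι] in
/-- **REDUCTION OF A BLOCK IS TRANSLATION BY ITS SHIFT**: for `p` in the unit block with label `ỹ`, `πp = p + n·(wrap_P ỹ − ỹ)`.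
[cite: Balaban1983RegularityDecay, (1.1) p.572 «B^k(y)», «periodic conditions», dictionary] -/
theorem twrap_eq_add_bshift {n : ℕ} (hn : 1 ≤ n) {P : Fin (d + 1) → ℕ} (hP : ∀ ν, 1 ≤ P ν) {p yb : Fin (d + 1) → ℤ}
    (hp : blk n p = yb) : twrap n P p = p + bshift n P yb := by
  funext ν
  have hn0 : (0 : ℤ) < n := by exact_mod_cast hn
  have hP0 : (0 : ℤ) < (P ν : ℤ) := by exact_mod_cast hP ν
  obtain ⟨hlo, -⟩ := base_le_of_blk hn hp
  have hlo' : (n : ℤ) * yb ν ≤ p ν := hlo ν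
  have hlt : p ν < (n : ℤ) * yb ν + n := by
    have hpν : p ν / (n : ℤ) = yb ν := by rw [← hp]; rfl
    have := Int.lt_mul_ediv_self_add (x := p ν) hn0
    rw [hpν] at this; linarith
  set r : ℤ := yb ν % (P ν : ℤ) with hr
  set q : ℤ := yb ν / (P ν : ℤ) with hq
  have hqr : (P ν : ℤ) * q + r = yb ν := Int.mul_ediv_add_emod _ _
  have hr0 : 0 ≤ r := Int.emod_nonneg _ hP0.ne'
  have hr1 : r < P ν := Int.emod_lt_of_pos _ hP0
  simp only [twrap_apply, per, bshift, wrap, Pi.add_apply, Nat.cast_mul, ← hr]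
  have hX0 : 0 ≤ p ν + (n : ℤ) * (r - yb ν) := by nlinarith
  have hX1 : p ν + (n : ℤ) * (r - yb ν) < (n : ℤ) * P ν := by nlinarith
  have hdecomp : p ν = (p ν + (n : ℤ) * (r - yb ν)) + ((n : ℤ) * P ν) * q := by linear_combination (-(n : ℤ)) * hqr
  conv_lhs => rw [hdecomp]
  rw [Int.add_mul_emod_self_left, Int.emod_eq_of_lt hX0 hX1]

section Intertwine

variable (F : OrthFlow ι) {n : ℕ} (hn : 1 ≤ n) {P : Fin (d + 1) → ℕ} (hP : ∀ ν, 1 ≤ P ν) (h3 : ∀ ν, 3 ≤ per n P ν)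
  {ΩT : Finset (Fin (d + 1) → ℤ)} (hΩ : ΩT ⊆ boxDom P) (R : ℕ)

/-- the torus label under a lifted label. [cite: Balaban1983RegularityDecay, (1.1) p.572, dictionary] -/
def projY (yb : ↥(liftLabels P R ΩT)) : ↥ΩT := ⟨wrap P yb.1, ((mem_liftLabels_iff hP hΩ).1 yb.2).1⟩

include hn h3 in
/-- **THE BLOCK TRANSPORTERS AGREE**: for a site `x̃′` in the block with label `ỹ`, the lattice transporter
`U(A^per(Γ_{ỹ,x̃′}))` from the block's base corner equals the torus transporter `U(A(Γ_{πỹ, πx̃′}))` (the staircase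
translates by the block shift, the periodic field on its bonds is the torus field on the reduced bonds).
[cite: Balaban1983RegularityDecay, (1.4) p.572 «U(A(Γ^{(k)}_{y,x}))»] -/
theorem contourTrans_lift (κ : ℝ) (Ac : (Fin (d + 1) → ℤ) → Fin (d + 1) → ℝ) (yb : ↥(liftLabels P R ΩT))
    (x' : ↥(fineDom n (liftLabels P R ΩT))) (hx' : blk n x'.1 = yb.1) :
    contourTrans (fieldLink F κ fun a b : ↥(fineDom n (liftLabels P R ΩT)) => compField (perField n P Ac) a.1 b.1)
        (rbaseEmb hn (liftLabels P R ΩT)) (rstairContour hn (liftLabels P R ΩT)) yb x'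
      = contourTrans (fieldLink F κ fun a b : ↥(fineDom n ΩT) => torBond n P Ac a.1 b.1)
        (rbaseEmb hn ΩT) (rstairContour hn ΩT) (projY hP hΩ R yb) (proj hn hP hΩ R x') := by
  unfold contourTrans
  rw [transport_fieldLink, transport_fieldLink]
  congr 1
  congr 1
  -- pass to lattice-point lists
  rw [← lsum_map (fun p q : Fin (d + 1) → ℤ => compField (perField n P Ac) p q) Subtype.val,
    ← lsum_map (fun p q : Fin (d + 1) → ℤ => torBond n P Ac p q) Subtype.val,
    map_val_rstairContour, map_val_rstairContour, if_pos hx']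
  have hxT : blk n (proj hn hP hΩ R x').1 = (projY hP hΩ R yb).1 := by
    show blk n (twrap n P x'.1) = wrap P yb.1
    rw [blk_twrap hn, hx']
  rw [if_pos hxT]
  -- the torus staircase is the translate of the lattice staircase by the block shift
  have hbaseL : (rbaseEmb hn (liftLabels P R ΩT) yb).1 = fun i => (n : ℤ) * yb.1 i := rfl
  have hbaseT : (rbaseEmb hn ΩT (projY hP hΩ R yb)).1 = (fun i => (n : ℤ) * yb.1 i) + bshift n P yb.1 := by
    funext ν; simp [rbaseEmb, projY, bshift]; ring
  have hcornT : (fun i => (n : ℤ) * (projY hP hΩ R yb).1 i) = (fun i => (n : ℤ) * yb.1 i) + bshift n P yb.1 := by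
    funext ν; simp [projY, bshift]; ring
  have hend : (proj hn hP hΩ R x').1 = x'.1 + bshift n P yb.1 := by
    show twrap n P x'.1 = _; exact twrap_eq_add_bshift hn hP hx'
  rw [hbaseL, hbaseT, hcornT, hend, stair_add, lsum_map_add]
  -- bondwise along the staircase: consecutive points are lattice neighbours inside the block `yb`
  have hle : (fun i => (n : ℤ) * yb.1 i) ≤ x'.1 := (base_le_of_blk hn hx').1
  have hpath : PathRel (fun u v : Fin (d + 1) → ℤ => blk n u = yb.1 ∧ (v ∈ nbrs u ∧ blk n v = yb.1))
      (fun i => (n : ℤ) * yb.1 i) (stair (fun i => (n : ℤ) * yb.1 i) x'.1) := by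
    refine pathRel_chain (r := fun u v => v ∈ nbrs u) (P := fun u => blk n u = yb.1) _ _ (blk_mul hn yb.1) ?_
    refine pathRel_and (r := fun u v => v ∈ nbrs u) (P := fun u => blk n u = yb.1) _ _ (pathRel_stair hle) ?_
    intro z hz
    obtain ⟨h1, h2⟩ := B4Lower18Regular.mem_stair hle hz
    exact blk_of_between hn hx' h1 h2
  refine (lsum_congr_rel (r := fun u v : Fin (d + 1) → ℤ => blk n u = yb.1 ∧ (v ∈ nbrs u ∧ blk n v = yb.1))
    (fun u v huv => ?_) _ _ hpath).symm
  rw [← twrap_eq_add_bshift hn hP huv.1, ← twrap_eq_add_bshift hn hP huv.2.2, torBond_twrap_of_nbrs h3 Ac huv.2.1]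

include hP hΩ in
/-- the unique lift of a site of the torus region into a prescribed block of the lift. [cite: Balaban1983RegularityDecay, (1.1) p.572, dictionary] -/
theorem exists_lift_in_block (x : ↥(fineDom n (liftLabels P R ΩT))) (x' : ↥(fineDom n ΩT))
    (hb : blk n x'.1 = blk n (proj hn hP hΩ R x).1) :
    ∃ xL : ↥(fineDom n (liftLabels P R ΩT)), proj hn hP hΩ R xL = x' ∧ blk n xL.1 = blk n x.1 := by
  set w := bshift n P (blk n x.1) with hw
  have hblk : blk n (x'.1 - w) = blk n x.1 := by
    have h1 : x'.1 - w = x'.1 + fun ν => (n : ℤ) * (-(wrap P (blk n x.1) ν - blk n x.1 ν)) := by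
      funext ν; simp [hw, bshift]; ring
    rw [h1, blk_add_mul hn, hb, proj_val, blk_twrap hn]
    funext ν; simp
  have hmem : x'.1 - w ∈ fineDom n (liftLabels P R ΩT) := by
    rw [mem_fineDom hn, hblk]; exact (mem_fineDom hn).1 x.2
  refine ⟨⟨x'.1 - w, hmem⟩, Subtype.ext ?_, hblk⟩
  rw [proj_val]
  show twrap n P (x'.1 - w) = x'.1
  rw [twrap_eq_add_bshift hn hP hblk, ← hw, sub_add_cancel]

include hP hΩ in
/-- two sites of the lift in one block with the same reduction coincide. [cite: Balaban1983RegularityDecay, (1.1) p.572, dictionary] -/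
theorem eq_of_proj_eq_of_blk_eq {x₁ x₂ : ↥(fineDom n (liftLabels P R ΩT))}
    (hp : proj hn hP hΩ R x₁ = proj hn hP hΩ R x₂) (hb : blk n x₁.1 = blk n x₂.1) : x₁ = x₂ := by
  apply Subtype.ext
  have h1 := twrap_eq_add_bshift hn hP (rfl : blk n x₁.1 = blk n x₁.1)
  have h2 := twrap_eq_add_bshift hn hP hb.symm
  have hp' : twrap n P x₁.1 = twrap n P x₂.1 := congrArg Subtype.val hp
  rw [h1, h2] at hp'
  exact add_right_cancel hp'

include hP hΩ in
/-- the reduction of a site of the lift in the block of `x` has block label `blk(πx)`. [cite: Balaban1983RegularityDecay, (1.1) p.572, dictionary] -/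
theorem blk_proj_eq_of_blk_eq {x x' : ↥(fineDom n (liftLabels P R ΩT))} (hb : blk n x'.1 = blk n x.1) :
    blk n (proj hn hP hΩ R x').1 = blk n (proj hn hP hΩ R x).1 := by
  rw [proj_val, proj_val, blk_twrap hn, blk_twrap hn, hb]

include hP hΩ in
/-- at an interior site, a torus neighbour of the reduction has exactly the expected lift: a lattice neighbour in `Ω̃_R`.
[cite: Balaban1983RegularityDecay, p.572 «bonds», «periodic conditions», dictionary] -/
theorem exists_nbr_lift {x : ↥(fineDom n (liftLabels P R ΩT))} (hint : IsInt n P R x.1) {z' : ↥(fineDom n ΩT)}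
    (hz' : TNbr n P (proj hn hP hΩ R x).1 z'.1) :
    ∃ zL : ↥(fineDom n (liftLabels P R ΩT)), zL.1 ∈ nbrs x.1 ∧ proj hn hP hΩ R zL = z' := by
  obtain ⟨μ, h | h⟩ := hz'
  · -- `z′ = twrap(πx + e_μ) = twrap(x + e_μ)`
    have hz : twrap n P (x.1 + e1 μ) = z'.1 := by rw [h, proj_val, twrap_twrap_add]
    have hnb : x.1 + e1 μ ∈ nbrs x.1 := mem_nbrs.2 ⟨μ, Or.inl rfl⟩
    have hmem : x.1 + e1 μ ∈ fineDom n (liftLabels P R ΩT) := nbr_mem_lift hn hP hΩ R hint hnb (by rw [hz]; exact z'.2)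
    exact ⟨⟨x.1 + e1 μ, hmem⟩, hnb, Subtype.ext hz⟩
  · -- `πx = twrap(z′ + e_μ)`: the lift is `x − e_μ`
    have hz : twrap n P (x.1 - e1 μ) = z'.1 := by
      have h' : twrap n P x.1 = twrap n P (z'.1 + e1 μ) := by rw [← proj_val hn hP hΩ R x]; exact h
      have := congrArg (fun w => twrap n P (w + -e1 μ)) h'
      simp only [twrap_twrap_add] at this
      rw [show x.1 + -e1 μ = x.1 - e1 μ by abel, show z'.1 + e1 μ + -e1 μ = z'.1 by abel] at this
      rw [this, twrap_eq_self (val_mem_perBox hn hΩ z')]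
    have hnb : x.1 - e1 μ ∈ nbrs x.1 := mem_nbrs.2 ⟨μ, Or.inr rfl⟩
    have hmem : x.1 - e1 μ ∈ fineDom n (liftLabels P R ΩT) := nbr_mem_lift hn hP hΩ R hint hnb (by rw [hz]; exact z'.2)
    exact ⟨⟨x.1 - e1 μ, hmem⟩, hnb, Subtype.ext hz⟩

include hn hP h3 hΩ in
/-- **THE INTERTWINING IDENTITY FOR (1.6)**: at an interior site of the lift,
`(H^{ℤ}_{Ω̃_R}(A^per)(u∘π))(x̃) = (H^{T}_{Ω}(A)u)(πx̃)` — the lattice Neumann operator at the periodic field acting on a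
pulled-back field is the torus operator acting on the field (bonds, blocks, contours and links correspond under `π`).
[cite: Balaban1983RegularityDecay, (1.3)–(1.6) p.572 «operators on subsets of a torus T_η … periodic conditions»] -/
theorem fld_regionOp_pull (e a m2 : ℝ) (Ac : (Fin (d + 1) → ℤ) → Fin (d + 1) → ℝ)
    (u : ↥(fineDom n ΩT) × ι → ℝ) (x : ↥(fineDom n (liftLabels P R ΩT))) (hint : IsInt n P R x.1) :
    fld (regionOp F e hn a m2 (liftLabels P R ΩT) (perField n P Ac) *ᵥ pull hn hP hΩ R u) x
      = fld (torusOp F e hn a m2 P ΩT Ac *ᵥ u) (proj hn hP hΩ R x) := by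
  classical
  set WL := fieldLink F (e / n) (fun a b : ↥(fineDom n (liftLabels P R ΩT)) => compField (perField n P Ac) a.1 b.1) with hWL
  set TL := contourTrans WL (rbaseEmb hn (liftLabels P R ΩT)) (rstairContour hn (liftLabels P R ΩT)) with hTL
  set WT := fieldLink F (e / n) (fun a b : ↥(fineDom n ΩT) => torBond n P Ac a.1 b.1) with hWT
  set TT := contourTrans WT (rbaseEmb hn ΩT) (rstairContour hn ΩT) with hTT
  have hWLt : ∀ z z' : ↥(fineDom n (liftLabels P R ΩT)), (WL z' z)ᵀ = WL z z' := fun z z' => by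
    have h' := fieldLink_rev F (e / n) (A := fun u v : ↥(fineDom n (liftLabels P R ΩT)) => compField (perField n P Ac) u.1 v.1)
      (x := z) (y := z') (compField_rev _ z.1 z'.1)
    rw [hWL, h', Matrix.transpose_transpose]
  have hWLo : ∀ z z' : ↥(fineDom n (liftLabels P R ΩT)), (WL z z')ᵀ * WL z z' = 1 := fun z z' => fieldLink_orth F _ _ z z'
  have hWTt : ∀ z z' : ↥(fineDom n ΩT), (WT z' z)ᵀ = WT z z' := fun z z' => by
    have h' := fieldLink_rev F (e / n) (A := fun u v : ↥(fineDom n ΩT) => torBond n P Ac u.1 v.1)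
      (x := z) (y := z') (torBond_rev n P Ac z.1 z'.1)
    rw [hWT, h', Matrix.transpose_transpose]
  have hWTo : ∀ z z' : ↥(fineDom n ΩT), (WT z z')ᵀ * WT z z' = 1 := fun z z' => fieldLink_orth F _ _ z z'
  rw [regionOp, torusOp, b4Op, b4Op, ← hWL, ← hTL, ← hWT, ← hTT, fld_covOp_mulVec _ _ _ _ WL TL hWLt hWLo,
    fld_covOp_mulVec _ _ _ _ WT TT hWTt hWTo, fld_pull]
  set px := proj hn hP hΩ R x with hpx
  congr 1
  congr 1
  · ---------------- the Laplacian part, fibre by fibre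
    rw [← Finset.sum_fiberwise_of_maps_to (s := Finset.univ) (t := Finset.univ) (g := proj hn hP hΩ R)
      (fun z _ => Finset.mem_univ _)]
    refine Finset.sum_congr rfl fun z' _ => ?_
    -- inside the fibre of `z′` the pulled-back field takes the value `u(z′)`
    have hfib : ∀ z ∈ Finset.univ.filter (fun z : ↥(fineDom n (liftLabels P R ΩT)) => proj hn hP hΩ R z = z'),
        (regWt n (fineDom n (liftLabels P R ΩT)) z x + regWt n (fineDom n (liftLabels P R ΩT)) x z) • (fld u px - WL x z *ᵥ fld (pull hn hP hΩ R u) z)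
          = (2 * regWt n (fineDom n (liftLabels P R ΩT)) x z) • (fld u px - WL x z *ᵥ fld u z') := by
      intro z hz
      rw [fld_pull, (Finset.mem_filter.1 hz).2, regWt_symm (liftLabels P R ΩT) x z, two_mul]
    rw [Finset.sum_congr rfl hfib, torWt_symm, ← two_mul]
    by_cases hT : TNbr n P px.1 z'.1
    · obtain ⟨z₁, hz₁n, hz₁p⟩ := exists_nbr_lift hn hP hΩ R hint hT
      rw [Finset.sum_eq_single_of_mem z₁ (Finset.mem_filter.2 ⟨Finset.mem_univ _, hz₁p⟩)]
      · have hcL : regWt n (fineDom n (liftLabels P R ΩT)) x z₁ = (n : ℝ) ^ 2 / 2 := by simp [regWt, hz₁n]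
        have hcT : torWt n P (fineDom n ΩT) px z' = (n : ℝ) ^ 2 / 2 := by simp [torWt, hT]
        have hlink : WL x z₁ = WT px z' := by
          rw [hWL, hWT]
          show F.U (e / n * compField (perField n P Ac) x.1 z₁.1) = F.U (e / n * torBond n P Ac px.1 z'.1)
          rw [fieldLink_twrap_of_nbrs F (e / n) h3 Ac hz₁n, ← hz₁p]
          rfl
        rw [hcL, hcT, hlink]
      · intro z hz hne
        have hzp := (Finset.mem_filter.1 hz).2
        have hnot : z.1 ∉ nbrs x.1 := by
          intro hzn
          apply hne
          apply Subtype.ext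
          refine eq_of_nbrs_of_twrap_eq h3 hzn hz₁n ?_
          have := congrArg Subtype.val (hzp.trans hz₁p.symm)
          simpa [proj_val] using this
        simp [regWt, hnot]
    · have hcT : torWt n P (fineDom n ΩT) px z' = 0 := by simp [torWt, hT]
      rw [hcT, mul_zero, zero_smul]
      refine Finset.sum_eq_zero fun z hz => ?_
      have hzp := (Finset.mem_filter.1 hz).2
      have hnot : z.1 ∉ nbrs x.1 := by
        intro hzn
        apply hT
        have := tNbr_twrap_of_nbrs n P hzn
        rwa [← proj_val hn hP hΩ R x, ← proj_val hn hP hΩ R z, hzp] at this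
      simp [regWt, hnot]
  · ---------------- the block part, fibre by fibre
    congr 1
    set yb₀ : ↥(liftLabels P R ΩT) := ⟨blk n x.1, (mem_fineDom hn).1 x.2⟩ with hyb₀
    set y₀ : ↥ΩT := ⟨blk n px.1, (mem_fineDom hn).1 px.2⟩ with hy₀
    have hinnerL : ∀ x' : ↥(fineDom n (liftLabels P R ΩT)),
        (∑ y, (rBlkWt n (liftLabels P R ΩT) (fineDom n (liftLabels P R ΩT)) y x * rBlkWt n (liftLabels P R ΩT) (fineDom n (liftLabels P R ΩT)) y x') • ((TL y x)ᵀ * TL y x'))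
          = (if blk n x'.1 = blk n x.1 then 1 else 0 : ℝ) • ((TL yb₀ x)ᵀ * TL yb₀ x') := by
      intro x'
      rw [Finset.sum_eq_single yb₀]
      · congr 1
        simp only [rBlkWt, hyb₀]
        by_cases hx : blk n x'.1 = blk n x.1 <;> simp [hx]
      · intro y _ hy
        have : rBlkWt n (liftLabels P R ΩT) (fineDom n (liftLabels P R ΩT)) y x = 0 := by
          simp only [rBlkWt]; rw [if_neg]; intro hb; exact hy (Subtype.ext hb.symm)
        rw [this, zero_mul, zero_smul]
      · intro h; exact absurd (Finset.mem_univ _) h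
    have hinnerT : ∀ x' : ↥(fineDom n ΩT),
        (∑ y, (rBlkWt n ΩT (fineDom n ΩT) y px * rBlkWt n ΩT (fineDom n ΩT) y x') • ((TT y px)ᵀ * TT y x'))
          = (if blk n x'.1 = blk n px.1 then 1 else 0 : ℝ) • ((TT y₀ px)ᵀ * TT y₀ x') := by
      intro x'
      rw [Finset.sum_eq_single y₀]
      · congr 1
        simp only [rBlkWt, hy₀]
        by_cases hx : blk n x'.1 = blk n px.1 <;> simp [hx]
      · intro y _ hy
        have : rBlkWt n ΩT (fineDom n ΩT) y px = 0 := by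
          simp only [rBlkWt]; rw [if_neg]; intro hb; exact hy (Subtype.ext hb.symm)
        rw [this, zero_mul, zero_smul]
      · intro h; exact absurd (Finset.mem_univ _) h
    simp_rw [hinnerL, hinnerT, fld_pull]
    rw [← Finset.sum_fiberwise_of_maps_to (s := Finset.univ) (t := Finset.univ) (g := proj hn hP hΩ R)
      (fun z _ => Finset.mem_univ _)]
    refine Finset.sum_congr rfl fun x' _ => ?_
    have hfib : ∀ z ∈ Finset.univ.filter (fun z : ↥(fineDom n (liftLabels P R ΩT)) => proj hn hP hΩ R z = x'),
        ((if blk n z.1 = blk n x.1 then 1 else 0 : ℝ) • ((TL yb₀ x)ᵀ * TL yb₀ z)) *ᵥ fld u (proj hn hP hΩ R z)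
          = ((if blk n z.1 = blk n x.1 then 1 else 0 : ℝ) • ((TL yb₀ x)ᵀ * TL yb₀ z)) *ᵥ fld u x' := by
      intro z hz; rw [(Finset.mem_filter.1 hz).2]
    rw [Finset.sum_congr rfl hfib]
    -- the transporters of the block of `x` agree with the torus ones
    have hprojY : projY hP hΩ R yb₀ = y₀ := by
      apply Subtype.ext
      show wrap P (blk n x.1) = blk n px.1
      rw [hpx, proj_val, blk_twrap hn]
    have hTx : TL yb₀ x = TT y₀ px := by
      rw [hTL, hTT, hWL, hWT, contourTrans_lift F hn hP h3 hΩ R (e / n) Ac yb₀ x rfl, hprojY]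
    by_cases hbx : blk n x'.1 = blk n px.1
    · obtain ⟨x₁, hx₁p, hx₁b⟩ := exists_lift_in_block hn hP hΩ R x x' hbx
      rw [Finset.sum_eq_single_of_mem x₁ (Finset.mem_filter.2 ⟨Finset.mem_univ _, hx₁p⟩)]
      · have hTx' : TL yb₀ x₁ = TT y₀ x' := by
          rw [hTL, hTT, hWL, hWT, contourTrans_lift F hn hP h3 hΩ R (e / n) Ac yb₀ x₁ hx₁b, hprojY, hx₁p]
        rw [if_pos hx₁b, if_pos hbx, hTx, hTx']
      · intro z hz hne
        have hzp := (Finset.mem_filter.1 hz).2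
        have hnb : ¬ blk n z.1 = blk n x.1 := by
          intro hb
          exact hne (eq_of_proj_eq_of_blk_eq hn hP hΩ R (hzp.trans hx₁p.symm) (hb.trans hx₁b.symm))
        rw [if_neg hnb, zero_smul, Matrix.zero_mulVec]
    · rw [if_neg hbx, zero_smul, Matrix.zero_mulVec]
      refine Finset.sum_eq_zero fun z hz => ?_
      have hzp := (Finset.mem_filter.1 hz).2
      have hnb : ¬ blk n z.1 = blk n x.1 := by
        intro hb
        apply hbx
        rw [← hzp]
        exact blk_proj_eq_of_blk_eq hn hP hΩ R hb
      rw [if_neg hnb, zero_smul, Matrix.zero_mulVec]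

include hn hP h3 hΩ in
/-- **THE INTERTWINING IDENTITY FOR THE COVARIANT DERIVATIVE (1.3)**: at an interior site of the lift,
`(D^{ℤ}_{A^per,μ}(u∘π))(x̃) = (D^{T}_{A,μ}u)(πx̃)`. [cite: Balaban1983RegularityDecay, (1.3) p.572 «periodic conditions»] -/
theorem fld_regionDeriv_pull (e : ℝ) (Ac : (Fin (d + 1) → ℤ) → Fin (d + 1) → ℝ) (μ : Fin (d + 1))
    (u : ↥(fineDom n ΩT) × ι → ℝ) (x : ↥(fineDom n (liftLabels P R ΩT))) (hint : IsInt n P R x.1) :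
    fld (regionDeriv F e n (liftLabels P R ΩT) (perField n P Ac) μ *ᵥ pull hn hP hΩ R u) x
      = fld (torusDeriv F e n P ΩT Ac μ *ᵥ u) (proj hn hP hΩ R x) := by
  have hpz : twrap n P ((proj hn hP hΩ R x).1 + e1 μ) = twrap n P (x.1 + e1 μ) := by rw [proj_val, twrap_twrap_add]
  by_cases hmem : twrap n P (x.1 + e1 μ) ∈ fineDom n ΩT
  · have hmemL : x.1 + e1 μ ∈ fineDom n (liftLabels P R ΩT) :=
      nbr_mem_lift hn hP hΩ R hint (mem_nbrs.2 ⟨μ, Or.inl rfl⟩) hmem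
    have hmemT : twrap n P ((proj hn hP hΩ R x).1 + e1 μ) ∈ fineDom n ΩT := by rw [hpz]; exact hmem
    rw [regionDeriv, torusDeriv, fld_covDeriv_mulVec_of_mem _ _ _ hmemL, fld_tcovDeriv_mulVec_of_mem _ _ _ _ hmemT,
      fld_pull, fld_pull]
    have hproj : proj hn hP hΩ R ⟨x.1 + e1 μ, hmemL⟩ = ⟨twrap n P ((proj hn hP hΩ R x).1 + e1 μ), hmemT⟩ :=
      Subtype.ext (by rw [proj_val]; exact hpz.symm)
    rw [hproj]
    have hlink : fieldLink F (e / n) (fun u v : ↥(fineDom n (liftLabels P R ΩT)) => compField (perField n P Ac) u.1 v.1)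
          x ⟨x.1 + e1 μ, hmemL⟩
        = fieldLink F (e / n) (fun u v : ↥(fineDom n ΩT) => torBond n P Ac u.1 v.1) (proj hn hP hΩ R x)
          ⟨twrap n P ((proj hn hP hΩ R x).1 + e1 μ), hmemT⟩ := by
      show F.U (e / n * compField (perField n P Ac) x.1 (x.1 + e1 μ))
        = F.U (e / n * torBond n P Ac (proj hn hP hΩ R x).1 (twrap n P ((proj hn hP hΩ R x).1 + e1 μ)))
      rw [fieldLink_twrap_of_nbrs F (e / n) h3 Ac (p := x.1) (q := x.1 + e1 μ) (mem_nbrs.2 ⟨μ, Or.inl rfl⟩), ← hpz,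
        proj_val]
    rw [hlink]
  · have hmemL : x.1 + e1 μ ∉ fineDom n (liftLabels P R ΩT) := by
      intro h
      exact hmem ((mem_fineDom_lift_iff hn hP hΩ).1 h).1
    have hmemT : twrap n P ((proj hn hP hΩ R x).1 + e1 μ) ∉ fineDom n ΩT := by rw [hpz]; exact hmem
    rw [regionDeriv, torusDeriv, fld_covDeriv_mulVec_of_not_mem _ _ _ hmemL, fld_tcovDeriv_mulVec_of_not_mem _ _ _ _ hmemT]

end Intertwine

end

end Literature.MathematicalPhysics.QuantumFieldTheory.Balaban1983to89.B4TorusRegionLift
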